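import Summits.CriticalPhenomena.SAWScalingLimit.Theorems.SAWReversalUpgradeAttachNoReturnEvents
import Summits.CriticalPhenomena.SAWScalingLimit.Theorems.SAWReversalUpgradeAttachNoReturnFallback
import Summits.CriticalPhenomena.SAWScalingLimit.Theorems.SAWReversalUpgradeAttachNoReturnPolyline
import HarnessLib

/-!
# Route `SAWReversalUpgrade`, support `AttachNoReturn` (stmt-CriticalPhenomena-18057):
# for small mesh, endpoint events of the attached SAW are events of the SAW polyline

Helper file for the proof of
`Summit.CriticalPhenomena.SAWScalingLimit.Theses.SAWReversalUpgrade.AttachNoReturn`.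

Along `δ → 0⁺`, for an endpoint approximation `(A δ, B δ)` of the Dobrushin domain `(D; a, b)`
and an eventually-standard attachment `att` (the route's `let`-block, read as
`att δ γ ∈ AttachReversal.standardCurves …` by `Iff.rfl`), the separation hypotheses of the
deterministic files hold eventually: the access segment shrinks into any ball about `a`
(`meshPoint δ (A δ) → a`, continuity of `ψ` at `a` and of `Φ` at `0`), the exit ray into any ball
about `b` (`meshPoint δ (B δ) → b`, `‖ψ‖ → ∞` at `b`, `Φ → b` at `∞`), and the pushed polyline
is uniformly close to the polyline (`FaithfulAttach.exists_squeeze_close`, squeeze angle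
`min δ (1/2) → 0`). Consequently (`eventually_event_pt_zero`, `eventually_event_pt_one`): for
every `ε, r₀ > 0` there is `r > 0` such that for all small `δ` and every SAW `γ`, an `(ε, r)` deep
return of `att δ γ` to `a` forces an `(ε/2, r₀)` deep return of the polyline of `γ`, and an
`(r, ε)` escape of `att δ γ` from `b` forces an `(ε/2, r₀)` deep return to `b` of the polyline of
the REVERSED walk (`toCurve_reverse_transfer`); the degenerate attachments are excluded by
`fallback_no_return` / `fallback_no_escape`.
-/

noncomputable section

open Set Filter Metric Complex Function
open scoped Topology unitInterval
open UpperHalfPlane (upperHalfPlaneSet)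
open Literature.Probability.RandomPlanarGeometry Literature.Probability.LatticeModels
open Literature.Probability.RandomPlanarGeometry.SAW

namespace Summit.CriticalPhenomena.SAWScalingLimit.Theorems

namespace AttachNoReturn

open AttachReversal FaithfulAttach

variable {D : DobrushinDomain} {A B : ℝ → Site 2} {φ : ConformalEquiv upperHalfPlaneSet D.carrier}
  {att : (δ : ℝ) → DomainSAW D.carrier δ (A δ) (B δ) → Curve ℂ}

section Eventually

/-- For small `δ`: `δ > 0` and the lattice endpoints are distinct (their mesh points converge to
the distinct marked points). -/
theorem eventually_pos_and_ne (hAB : IsEndpointApprox D A B) :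
    ∀ᶠ δ in 𝓝[>] (0 : ℝ), 0 < δ ∧ A δ ≠ B δ := by
  have hd : 0 < dist (D.pt 0) (D.pt 1) := dist_pos.2 (D.pt_injective.ne (by decide))
  have h1 := Metric.tendsto_nhds.1 hAB.tendsto_fst _ (half_pos hd)
  have h2 := Metric.tendsto_nhds.1 hAB.tendsto_snd _ (half_pos hd)
  filter_upwards [self_mem_nhdsWithin, h1, h2] with δ hδ hA hB
  refine ⟨hδ, fun h => ?_⟩
  rw [h, dist_comm] at hA
  have := dist_triangle (D.pt 0) (meshPoint δ (B δ)) (D.pt 1)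
  linarith

/-- The polyline of a SAW with distinct endpoints, as the data `(P, R)` of the deterministic files:
in `closure D`, with end points in `D`, flat. -/
theorem polyline_data {δ : ℝ} (hδ : 0 < δ) (hne : A δ ≠ B δ) (γ : DomainSAW D.carrier δ (A δ) (B δ)) :
    (∀ u, projLine (γ.walk.toCurve (meshPoint δ)) u =
        γ.walk.toCurve (meshPoint δ) (projIcc 0 1 zero_le_one u)) ∧
      (∀ t, γ.walk.toCurve (meshPoint δ) t ∈ closure D.carrier) ∧
      γ.walk.toCurve (meshPoint δ) 0 ∈ D.carrier ∧ γ.walk.toCurve (meshPoint δ) 1 ∈ D.carrier ∧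
      (∀ s t : I, γ.walk.toCurve (meshPoint δ) s = γ.walk.toCurve (meshPoint δ) t →
        ∀ w : I, s ≤ w → w ≤ t → γ.walk.toCurve (meshPoint δ) w = γ.walk.toCurve (meshPoint δ) s) := by
  obtain ⟨hA, hB⟩ := meshPoint_mem_of_ne γ hne
  refine ⟨fun u => rfl, toCurve_mem_closure γ hne, ?_, ?_, fun s t h w hsw hwt => toCurve_flat hδ γ h w hsw hwt⟩
  · rw [SimpleGraph.Walk.toCurve_apply_zero]; exact hA
  · rw [toCurve_apply_one]; exact hB

variable (hAB : IsEndpointApprox D A B) (hφ : D.IsChordalUniformizing φ)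
  (hatt : ∀ᶠ δ in 𝓝[>] (0 : ℝ), ∀ γ : DomainSAW D.carrier δ (A δ) (B δ),
    att δ γ ∈ standardCurves (D.pt 0) (D.pt 1) φ.boundaryExtension (min δ (1 / 2))
      (projLine (γ.walk.toCurve (meshPoint δ))) D.carrier)
include hAB hφ hatt

/-- **The separation hypotheses hold for small mesh.** For every `ρ, Δ > 0`, eventually in `δ`:
`δ > 0`, `A δ ≠ B δ`, the attachment is standard, the pushed polyline is `Δ`-close, the access
segment is within `ρ` of `a` and the exit ray within `ρ` of `b` (in the form consumed by
`event_pt_zero` / `event_pt_one`). -/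
theorem eventually_hypotheses {ρ Δ : ℝ} (hρ : 0 < ρ) (hΔ : 0 < Δ) :
    ∀ᶠ δ in 𝓝[>] (0 : ℝ), 0 < δ ∧ A δ ≠ B δ ∧ 0 < min δ (1 / 2) ∧ min δ (1 / 2) ≤ 1 / 2 ∧
      (∀ γ : DomainSAW D.carrier δ (A δ) (B δ),
        att δ γ ∈ standardCurves (D.pt 0) (D.pt 1) φ.boundaryExtension (min δ (1 / 2))
          (projLine (γ.walk.toCurve (meshPoint δ))) D.carrier) ∧
      (∀ z : ℂ, 0 ≤ z.im → dist (φ.boundaryExtension (squeeze (min δ (1 / 2)) z))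
        (φ.boundaryExtension z) < Δ) ∧
      (∀ γ : DomainSAW D.carrier δ (A δ) (B δ), ∀ z : ℂ, 0 ≤ z.im →
        ‖z‖ ≤ ‖hinv φ.boundaryExtension (γ.walk.toCurve (meshPoint δ) 0)‖ →
          dist (φ.boundaryExtension z) (D.pt 0) ≤ ρ) ∧
      (∀ γ : DomainSAW D.carrier δ (A δ) (B δ), ∀ z : ℂ, 0 ≤ z.im →
        ‖hinv φ.boundaryExtension (γ.walk.toCurve (meshPoint δ) 1)‖ ≤ ‖z‖ →
          dist (φ.boundaryExtension z) (D.pt 1) ≤ ρ) := by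
  -- access: `Φ` small near `0`, `ψ` small near `a`, `meshPoint δ (A δ) → a`
  obtain ⟨m, hm, hΦ0⟩ := exists_norm_lt_dist_bext_lt hφ hρ
  obtain ⟨ηa, hηa, hψa⟩ := exists_dist_lt_norm_invFun_lt hφ hm
  have hA := Metric.tendsto_nhds.1 hAB.tendsto_fst ηa hηa
  -- exit: `Φ → b` at `∞`, `‖ψ‖ → ∞` at `b`, `meshPoint δ (B δ) → b`
  obtain ⟨M, -, hΦinf⟩ := exists_norm_le_dist_bext_lt hφ hρ
  obtain ⟨ηb, hηb, hψb⟩ := exists_dist_lt_le_norm_invFun hφ M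
  have hB := Metric.tendsto_nhds.1 hAB.tendsto_snd ηb hηb
  -- squeeze
  obtain ⟨e₀, he₀, -, hsq⟩ := exists_squeeze_close hφ hΔ
  have he : ∀ᶠ δ in 𝓝[>] (0 : ℝ), δ < e₀ := mem_nhdsWithin_of_mem_nhds (Iio_mem_nhds he₀)
  filter_upwards [eventually_pos_and_ne hAB, hatt, hA, hB, he] with δ ⟨hδ, hne⟩ hstd hAδ hBδ hδe
  have he0 : 0 < min δ (1 / 2) := lt_min hδ (by norm_num)
  refine ⟨hδ, hne, he0, min_le_right _ _, hstd,
    hsq _ he0 ((min_le_left _ _).trans hδe.le), fun γ z hz hzn => ?_, fun γ z hz hzn => ?_⟩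
  · obtain ⟨-, -, hP0, -⟩ := polyline_data hδ hne γ
    rw [SimpleGraph.Walk.toCurve_apply_zero] at hzn hP0
    have h1 := hψa _ (subset_closure hP0) hAδ
    exact (hΦ0 z hz (hzn.trans_lt h1)).le
  · obtain ⟨-, -, -, hP1, -⟩ := polyline_data hδ hne γ
    rw [toCurve_apply_one] at hzn hP1
    have hb : meshPoint δ (B δ) ≠ D.pt 1 := fun h => MarkedDomain.pt_notMem_carrier D 1 (h ▸ hP1)
    have h1 := hψb _ (subset_closure hP1) hb hBδ
    exact (hΦinf z hz (h1.le.trans hzn)).le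

/-- **Deep returns of the attached walk are deep returns of the walk** (for small mesh). -/
theorem eventually_event_pt_zero {ε r₀ : ℝ} (hε : 0 < ε) (hr₀ : 0 < r₀) :
    ∃ r > 0, ∀ᶠ δ in 𝓝[>] (0 : ℝ), ∀ γ : DomainSAW D.carrier δ (A δ) (B δ), ∀ s t : I, s < t →
      ε ≤ dist (att δ γ s) (D.pt 0) → dist (att δ γ t) (D.pt 0) ≤ r →
      ∃ s' t' : I, s' < t' ∧ ε / 2 ≤ dist (γ.walk.toCurve (meshPoint δ) s') (D.pt 0) ∧
        dist (γ.walk.toCurve (meshPoint δ) t') (D.pt 0) ≤ r₀ := by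
  have hd : 0 < dist (D.pt 0) (D.pt 1) := dist_pos.2 (D.pt_injective.ne (by decide))
  obtain ⟨rfb, hrfb, hfb⟩ := fallback_no_return hφ hε
  set ρ := min (ε / 2) (dist (D.pt 0) (D.pt 1) / 4) with hρdef
  have hρ : 0 < ρ := by positivity
  set Δ := min (ε / 2) (r₀ / 2) with hΔdef
  have hΔ : 0 < Δ := by positivity
  refine ⟨min (min (r₀ / 2) (dist (D.pt 0) (D.pt 1) / 4)) rfb, by positivity, ?_⟩
  filter_upwards [eventually_hypotheses hAB hφ hatt hρ hΔ] with δ ⟨hδ, hne, he0, he1, hstd, hclose, hρa, hρb⟩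
  intro γ s t hst hfar hnear
  obtain ⟨hR, hPcl, hP0, hP1, hflat⟩ := polyline_data hδ hne γ
  have hc := hstd γ
  have hρε : ρ < ε := by have := min_le_left (ε / 2) (dist (D.pt 0) (D.pt 1) / 4); linarith
  have hsep : ρ + ρ < dist (D.pt 0) (D.pt 1) := by
    have := min_le_right (ε / 2) (dist (D.pt 0) (D.pt 1) / 4); linarith
  have hr4 : min (min (r₀ / 2) (dist (D.pt 0) (D.pt 1) / 4)) rfb ≤ dist (D.pt 0) (D.pt 1) / 4 :=
    (min_le_left _ _).trans (min_le_right _ _)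
  have hr2 : min (min (r₀ / 2) (dist (D.pt 0) (D.pt 1) / 4)) rfb ≤ r₀ / 2 :=
    (min_le_left _ _).trans (min_le_left _ _)
  have hrr : min (min (r₀ / 2) (dist (D.pt 0) (D.pt 1) / 4)) rfb + ρ < dist (D.pt 0) (D.pt 1) := by
    have := min_le_right (ε / 2) (dist (D.pt 0) (D.pt 1) / 4); linarith
  by_cases huv : uMid (D.pt 0) (D.pt 1) φ.boundaryExtension (min δ (1 / 2))
      (projLine (γ.walk.toCurve (meshPoint δ))) <
    vMid (D.pt 0) (D.pt 1) φ.boundaryExtension (min δ (1 / 2)) (projLine (γ.walk.toCurve (meshPoint δ)))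
  · obtain ⟨x, hx, y, hy, hxy, hZx, hZy⟩ := event_pt_zero hφ he0 he1 hR hPcl hP0 hP1 (hρa γ) (hρb γ)
      hsep hflat hc huv hρε hrr hst hfar hnear
    have hdx := dist_attZ_lt hφ hR hPcl hΔ hclose x
    have hdy := dist_attZ_lt hφ hR hPcl hΔ hclose y
    rw [hZx, trim_R_of_mem hR hx] at hdx
    rw [hZy, trim_R_of_mem hR hy] at hdy
    refine ⟨⟨x, hx⟩, ⟨y, hy⟩, hxy, ?_, ?_⟩
    · have h1 := dist_triangle (att δ γ s) (γ.walk.toCurve (meshPoint δ) ⟨x, hx⟩) (D.pt 0)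
      have h2 : Δ ≤ ε / 2 := min_le_left _ _
      linarith
    · have h1 := dist_triangle (γ.walk.toCurve (meshPoint δ) ⟨y, hy⟩) (att δ γ t) (D.pt 0)
      have h2 : Δ ≤ r₀ / 2 := min_le_right _ _
      rw [dist_comm] at hdy
      linarith
  · exfalso
    obtain ⟨hcinj, hcs, hct, -, -, hcfb⟩ := hc
    exact hfb (att δ γ) hcinj hcs hct (hcfb huv) s t hst hfar (hnear.trans (min_le_right _ _))

/-- **Escapes of the attached walk are deep returns of the reversed walk** (for small mesh). -/
theorem eventually_event_pt_one {ε r₀ : ℝ} (hε : 0 < ε) (hr₀ : 0 < r₀) :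
    ∃ r > 0, ∀ᶠ δ in 𝓝[>] (0 : ℝ), ∀ γ : DomainSAW D.carrier δ (A δ) (B δ), ∀ s t : I, s < t →
      dist (att δ γ s) (D.pt 1) ≤ r → ε ≤ dist (att δ γ t) (D.pt 1) →
      ∃ s' t' : I, s' < t' ∧ ε / 2 ≤ dist (γ.walk.reverse.toCurve (meshPoint δ) s') (D.pt 1) ∧
        dist (γ.walk.reverse.toCurve (meshPoint δ) t') (D.pt 1) ≤ r₀ := by
  have hd : 0 < dist (D.pt 0) (D.pt 1) := dist_pos.2 (D.pt_injective.ne (by decide))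
  obtain ⟨rfb, hrfb, hfb⟩ := fallback_no_escape hφ hε
  set r₁ := min r₀ (ε / 4) with hr₁def
  have hr₁ : 0 < r₁ := by positivity
  set ρ := min (ε / 2) (dist (D.pt 0) (D.pt 1) / 4) with hρdef
  have hρ : 0 < ρ := by positivity
  set Δ := min (ε / 4) (r₁ / 2) with hΔdef
  have hΔ : 0 < Δ := by positivity
  refine ⟨min (min (r₁ / 2) (dist (D.pt 0) (D.pt 1) / 4)) rfb, by positivity, ?_⟩
  filter_upwards [eventually_hypotheses hAB hφ hatt hρ hΔ] with δ ⟨hδ, hne, he0, he1, hstd, hclose, hρa, hρb⟩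
  intro γ s t hst hnear hfar
  obtain ⟨hR, hPcl, hP0, hP1, hflat⟩ := polyline_data hδ hne γ
  have hc := hstd γ
  have hρε : ρ < ε := by have := min_le_left (ε / 2) (dist (D.pt 0) (D.pt 1) / 4); linarith
  have hsep : ρ + ρ < dist (D.pt 0) (D.pt 1) := by
    have := min_le_right (ε / 2) (dist (D.pt 0) (D.pt 1) / 4); linarith
  have hr2 : min (min (r₁ / 2) (dist (D.pt 0) (D.pt 1) / 4)) rfb ≤ r₁ / 2 :=
    (min_le_left _ _).trans (min_le_left _ _)
  have hrr : min (min (r₁ / 2) (dist (D.pt 0) (D.pt 1) / 4)) rfb + ρ < dist (D.pt 0) (D.pt 1) := by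
    have h1 := min_le_right (ε / 2) (dist (D.pt 0) (D.pt 1) / 4)
    have h2 : min (min (r₁ / 2) (dist (D.pt 0) (D.pt 1) / 4)) rfb ≤ dist (D.pt 0) (D.pt 1) / 4 :=
      (min_le_left _ _).trans (min_le_right _ _)
    linarith
  have hr₁ε : r₁ ≤ ε / 4 := min_le_right _ _
  have hr₁r : r₁ ≤ r₀ := min_le_left _ _
  by_cases huv : uMid (D.pt 0) (D.pt 1) φ.boundaryExtension (min δ (1 / 2))
      (projLine (γ.walk.toCurve (meshPoint δ))) <
    vMid (D.pt 0) (D.pt 1) φ.boundaryExtension (min δ (1 / 2)) (projLine (γ.walk.toCurve (meshPoint δ)))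
  · obtain ⟨x, hx, y, hy, hxy, hZx, hZy⟩ := event_pt_one hφ he0 he1 hR hPcl hP0 hP1 (hρa γ) (hρb γ)
      hsep hflat hc huv hρε hrr hst hnear hfar
    have hdx := dist_attZ_lt hφ hR hPcl hΔ hclose x
    have hdy := dist_attZ_lt hφ hR hPcl hΔ hclose y
    rw [hZx, trim_R_of_mem hR hx] at hdx
    rw [hZy, trim_R_of_mem hR hy] at hdy
    -- the polyline is `r₁`-close to `b` at `x` and `ε/2`-far at `y > x`
    have hPx : dist (γ.walk.toCurve (meshPoint δ) ⟨x, hx⟩) (D.pt 1) ≤ r₁ := by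
      have h1 := dist_triangle (γ.walk.toCurve (meshPoint δ) ⟨x, hx⟩) (att δ γ s) (D.pt 1)
      have h2 : Δ ≤ r₁ / 2 := min_le_right _ _
      rw [dist_comm] at hdx
      linarith
    have hPy : ε / 2 ≤ dist (γ.walk.toCurve (meshPoint δ) ⟨y, hy⟩) (D.pt 1) := by
      have h1 := dist_triangle (att δ γ t) (γ.walk.toCurve (meshPoint δ) ⟨y, hy⟩) (D.pt 1)
      have h2 : Δ ≤ ε / 4 := min_le_left _ _
      linarith
    have hPne : γ.walk.toCurve (meshPoint δ) ⟨x, hx⟩ ≠ γ.walk.toCurve (meshPoint δ) ⟨y, hy⟩ := by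
      intro h
      rw [h] at hPx
      linarith
    -- read backwards along the reversed walk
    have hle : (⟨x, hx⟩ : I) ≤ ⟨y, hy⟩ := Subtype.mk_le_mk.2 hxy.le
    obtain ⟨s', t', hs't', hs', ht'⟩ := toCurve_reverse_transfer γ hle hPne
    refine ⟨s', t', hs't', ?_, ?_⟩
    · rw [hs']; exact hPy
    · rw [ht']; exact hPx.trans hr₁r
  · exfalso
    obtain ⟨hcinj, hcs, hct, -, -, hcfb⟩ := hc
    exact hfb (att δ γ) hcinj hcs hct (hcfb huv) s t hst (hnear.trans (min_le_right _ _)) hfar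

end Eventually

end AttachNoReturn

end Summit.CriticalPhenomena.SAWScalingLimit.Theorems
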